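import Summits.KontsevichZagierPeriods.KontsevichZagierPeriods.Theses.InverseLandau
import Summits.KontsevichZagierPeriods.KontsevichZagierPeriods.Theorems.LiouvilleUnfoldingLogPrimitiveNL
import Summits.KontsevichZagierPeriods.KontsevichZagierPeriods.Theorems.LogPrimitiveNL.Negative.DimZero
import Summits.KontsevichZagierPeriods.KontsevichZagierPeriods.Theorems.LogPrimitiveNL.Negative.BakerRelationSpan
import Summits.KontsevichZagierPeriods.KontsevichZagierPeriods.Theorems.TerasomaMultiplicationBetaCancellationStubMoebiusMove
import Literature.NumberTheory.Transcendental.KZRelationsLE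

/-!
# Sketch — crux `TateFamilyKernelCurves` (stmt-KontsevichZagierPeriods-9132), crux-ideate round 1, ideator 2

First-lemma signatures of the two idea cards (they only need to ELABORATE; `sorry` allowed here):

* card `baker-fibre-splitting`: `NumberFieldFibreKernel` (the transfer C⁺), `transfer`
  (C⁺ → crux), `baker_fibre_splitting` (Baker's theorem, relation-span form, split into the
  exact / modulus / angle parts of the fibre value), `modulus_part_mem_relations` (one instantiation
  of the CLOSED item `LiouvilleUnfolding.LogPrimitiveNL` at `n = 0`, via `Negative.DimZero`);
* card `circle-scissors-angle-part`: `arc_scissors` (integer combinations of arctangent arcs of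
  total angle `0` are relations: two tilings + `stub_moebiusMove`) and `angle_part_mem_relations`
  (the angle part of the fibre is a relation).

Tree constants used (all `lean search`ed / read in the tree this session):
`KZ.IntegralRep`, `KZ.of`, `KZ.relations`, `KZ.Equivalent`, `KZ.scale`, `KZ.scale_mem_relations`
(Literature/NumberTheory/Transcendental/KZCalculus.lean, KZRelationsLE.lean);
`Summit.KontsevichZagierPeriods.LiouvilleUnfolding.LogPrimitiveNL.LogPrimitiveNL_of`,
`…LogPrimitiveNL.Negative.DimZero`, `…Negative.dimZero_of_crux`, `…Negative.baker_relation_span_int`,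
`…Negative.baker_sum_eq_zero` (Theorems/LiouvilleUnfoldingLogPrimitiveNL.lean,
Theorems/LogPrimitiveNL/Negative/{DimZero,BakerRelationSpan}.lean);
`Summit.KontsevichZagierPeriods.KontsevichZagierPeriods.BetaCancellationLine.stub_moebiusMove`
(Theorems/TerasomaMultiplicationBetaCancellationStubMoebiusMove.lean);
`Literature.NumberTheory.Transcendental.baker_holds` (BakerLogarithmsConclusion.lean).
-/

noncomputable section

open Set MeasureTheory
open Literature.NumberTheory.Transcendental

namespace Summit.KontsevichZagierPeriods.KontsevichZagierPeriods.Cruxes.TateFamilyKernelCurves.SketchIdeator2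

open Summit.KontsevichZagierPeriods.KontsevichZagierPeriods.Theses.InverseLandau (TateFamilyKernelCurves)

/-! ## Card `baker-fibre-splitting` -/

/-- **Transfer C⁺ (no family).** A one-variable rational integrand with REAL ALGEBRAIC
coefficients, pole-free on `[0,1]`, whose integral over `(0,1)` vanishes, gives a KZ relation.
The crux is its specialisation at `P(·,ϖ₀)/Q(·,ϖ₀)` (coefficients in `ℚ(ϖ₀)`). -/
def NumberFieldFibreKernel : Prop :=
  ∀ (P Q : Polynomial ℝ), (∀ i, IsAlgebraic ℚ (P.coeff i)) → (∀ i, IsAlgebraic ℚ (Q.coeff i)) →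
    (∀ t ∈ Icc (0 : ℝ) 1, Q.eval t ≠ 0) →
    ∫ t in Ioo (0 : ℝ) 1, P.eval t / Q.eval t = 0 →
    ∀ r : KZ.IntegralRep 1, r.domain = {x | x 0 ∈ Ioo (0 : ℝ) 1} →
      EqOn r.integrand (fun x => P.eval (x 0) / Q.eval (x 0)) r.domain →
      KZ.of r ∈ KZ.relations

/-- The transfer is exact: C⁺ implies the crux (specialise the `MvPolynomial (Fin 2) ℚ` data at
the algebraic parameter `ϖ₀`; admissibility at `ϖ₀` is pole-freeness on `[0,1]`;
`Set.pi univ (fun _ => Ioo 0 1) = {x | x 0 ∈ Ioo 0 1}` for `Fin 1`). Bookkeeping only. -/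
theorem transfer : NumberFieldFibreKernel → TateFamilyKernelCurves := by
  sorry

/-- **First lemma of the card (Baker fibre splitting).** At the fibre, the value
`0 = ∫₀¹ P/Q = γ + Σⱼ (αⱼ log|gⱼ| + βⱼ arg gⱼ)` (γ = E(1) − E(0) the exact part, `gⱼ = (pⱼ − 1)/pⱼ`
the Landau number of the pole `pⱼ`, `αⱼ = 2 Re Aⱼ`, `βⱼ = −2 Im Aⱼ` from the residue `Aⱼ`, all
algebraic) SPLITS: `γ = 0`, and the modulus and angle coefficient vectors are real-algebraic
combinations of INTEGER vectors that are exact relations among the `log|gⱼ|`, resp. among the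
`arg gⱼ`. Proof: `baker_relation_span_int` + `baker_sum_eq_zero` (tree, from `baker_holds`) applied
to the `2m` logarithms `Log gⱼ`, `conj (Log gⱼ)` with coefficients `(αⱼ ∓ iβⱼ)/2`, then real and
imaginary parts of each integer relation. -/
theorem baker_fibre_splitting (m : ℕ) (g : Fin m → ℂ) (α β : Fin m → ℝ) (γ : ℝ)
    (hg : ∀ j, IsAlgebraic ℚ (g j)) (hg0 : ∀ j, g j ≠ 0)
    (hα : ∀ j, IsAlgebraic ℚ (α j)) (hβ : ∀ j, IsAlgebraic ℚ (β j)) (hγ : IsAlgebraic ℚ γ)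
    (hsum : γ + ∑ j, (α j * Real.log ‖g j‖ + β j * (g j).arg) = 0) :
    γ = 0 ∧
    (∃ (R : ℕ) (f : Fin R → Fin m → ℤ) (c : Fin R → ℝ), (∀ r, IsAlgebraic ℚ (c r)) ∧
      (∀ r, ∑ j, (f r j : ℝ) * Real.log ‖g j‖ = 0) ∧ ∀ j, α j = ∑ r, c r * f r j) ∧
    (∃ (R : ℕ) (f : Fin R → Fin m → ℤ) (c : Fin R → ℝ), (∀ r, IsAlgebraic ℚ (c r)) ∧
      (∀ r, ∑ j, (f r j : ℝ) * (g j).arg = 0) ∧ ∀ j, β j = ∑ r, c r * f r j) := by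
  sorry

/-- **Modulus part = one instantiation of a CLOSED item.** The `n = 0` case `Negative.DimZero` of
`LiouvilleUnfolding.LogPrimitiveNL` (proved in tree: `LogPrimitiveNL_of`) with constant
coefficients `hᵢ` and `Vᵢ(t) = (t − aᵢ)² + bᵢ²` (or `|t − pᵢ|` for a real pole) puts
`[[0,1], Σ hᵢ Vᵢ′/Vᵢ] − [pt, Σ hᵢ log (Vᵢ 1 / Vᵢ 0)]` in `KZ.relations`; when the modulus total
vanishes the point representation is `[pt, 0] ∈ relations`. Recorded here as the available input. -/
theorem modulus_part_input :
    Summit.KontsevichZagierPeriods.LiouvilleUnfolding.LogPrimitiveNL.Negative.DimZero :=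
  Summit.KontsevichZagierPeriods.LiouvilleUnfolding.LogPrimitiveNL.Negative.dimZero_of_crux
    Summit.KontsevichZagierPeriods.LiouvilleUnfolding.LogPrimitiveNL.LogPrimitiveNL_of

/-! ## Card `circle-scissors-angle-part` -/

/-- **First lemma of the card (arc scissors on `ℝP¹`).** An INTEGER combination of arctangent
arcs `[(0, xₖ), dt/(1+t²)]` (`xₖ ∈ (0,1)` real algebraic, i.e. angles in `(0, π/4)`) whose total
angle `Σ nₖ arctan xₖ` vanishes is a KZ relation. Proof: lay the positive and the negative copies
end to end (two tilings of `[0, T]` by the same total angle `T`), cut both at the merged cut points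
(rule 1a inside each arc, at points `tan(c − S) ∈ (0, xₖ)`, algebraic by the addition theorem),
and rotate every piece `[tan φ, tan ψ] ↦ [0, tan(ψ − φ)]` by ONE `stub_moebiusMove` (rule 2, Möbius
map with algebraic `(cos, sin)`, denominator positive since all angles lie in `[0, π/4)`): both
tilings become the SAME multiset of pieces. One-dimensional scissors congruence is detected by
length (Dupont, Example 5.8), here for the rotation group `arg ℚ̄ˣ` acting on its own orbit. -/
theorem arc_scissors (m : ℕ) (x : Fin m → ℝ) (n : Fin m → ℤ)
    (hx : ∀ k, IsAlgebraic ℚ (x k)) (hx0 : ∀ k, 0 < x k) (hx1 : ∀ k, x k < 1)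
    (hrel : ∑ k, (n k : ℝ) * Real.arctan (x k) = 0)
    (r : Fin m → KZ.IntegralRep 1)
    (hdom : ∀ k, (r k).domain = {y | y 0 ∈ Ioo 0 (x k)})
    (hint : ∀ k, EqOn (r k).integrand (fun y => 1 / (1 + (y 0) ^ 2)) (r k).domain) :
    ∑ k, n k • KZ.of (r k) ∈ KZ.relations := by
  sorry

/-- **The angle part of the fibre is a relation** (target of the card): for upper-half-plane poles
`pⱼ = aⱼ + i bⱼ` (`bⱼ > 0`, real algebraic `aⱼ, bⱼ`) and real algebraic weights `βⱼ` with vanishing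
total angle `Σ βⱼ θⱼ = 0`, `θⱼ = arctan((1−aⱼ)/bⱼ) − arctan(−aⱼ/bⱼ) = ∫₀¹ bⱼ dt/((t−aⱼ)²+bⱼ²)`,
the representation `[(0,1), Σ βⱼ bⱼ/((t−aⱼ)²+bⱼ²)]` lies in `KZ.relations`. Reduction: Baker
relation span (angle conjunct of `baker_fibre_splitting`) ⇒ `β = Σ_r c_r f_r` with integer angle
relations `f_r`; integrand additivity + `KZ.scale (c_r)` (`scale_mem_relations`) ⇒ integer case;
affine chart `u = (t − aⱼ)/bⱼ` (rule 2) ⇒ arcs `(−aⱼ/bⱼ, (1−aⱼ)/bⱼ)` with density `du/(1+u²)`;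
subdivision into arcs of angle `< π/4` rotated to start at `0` ⇒ `arc_scissors`. -/
theorem angle_part_mem_relations (m : ℕ) (a b β : Fin m → ℝ)
    (ha : ∀ j, IsAlgebraic ℚ (a j)) (hb : ∀ j, IsAlgebraic ℚ (b j)) (hβ : ∀ j, IsAlgebraic ℚ (β j))
    (hb0 : ∀ j, 0 < b j)
    (hrel : ∑ j, β j * (Real.arctan ((1 - a j) / b j) - Real.arctan ((0 - a j) / b j)) = 0)
    (r : KZ.IntegralRep 1) (hdom : r.domain = {y | y 0 ∈ Ioo (0 : ℝ) 1})
    (hint : EqOn r.integrand (fun y => ∑ j, β j * (b j / ((y 0 - a j) ^ 2 + (b j) ^ 2))) r.domain) :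
    KZ.of r ∈ KZ.relations := by
  sorry

/-! ## Card `tate-contraction-homotopy` -/

/-- **First lemma of the card (Tate homotopy certificate = complex `DlogLoopRelator`).** Let
`Ψ = U + iV` be a complex-valued function on the closed square `[0,1]²` (coordinates `z = x 0`,
`w = x 1`) with `ℚ`-semialgebraic real and imaginary parts, `C¹`, NOWHERE ZERO, constant `= 1` on the
Tate edge `w = 0`, and with EQUAL values on the two sides `z = 0`, `z = 1` (loop condition for every
`w`). Then the angle form `Im(Ψ_z/Ψ)(·,1) = (U V_z − V U_z)/(U²+V²)` AND the modulus form
`Re(Ψ_z/Ψ)(·,1) = (U U_z + V V_z)/(U²+V²)` of the fibre loop `Ψ(·,1)` are KZ relations on `(0,1)`: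
three moves each (Newton–Leibniz along `w` with the semialgebraic primitive-free closed form
`Im/Re(Ψ_w/Ψ) dw + Im/Re(Ψ_z/Ψ) dz`, coordinate swap, Newton–Leibniz along `z`; the side terms are
the SAME representation twice and cancel formally, the Tate edge has integrand `0`). In the line,
`Ψ(z,w) = ∏ₚ (1 − z/p(wϖ₀))^{n_p}` for a defect-lattice vector `n`: `Ψ(0,w) = 1 = Ψ(1,w)` is the
Landau relation, `Ψ(z,0) = 1` is the Tate point, `Ψ ≠ 0` is admissibility on `(0, ϖ₀]`. -/
theorem tate_homotopy_certificate (U V Uz Vz Uw Vw : (Fin 2 → ℝ) → ℝ)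
    (hU : IsSemialgebraicFunOn ℚ (Icc (0 : Fin 2 → ℝ) 1) U)
    (hV : IsSemialgebraicFunOn ℚ (Icc (0 : Fin 2 → ℝ) 1) V)
    (hcont : ContinuousOn U (Icc 0 1) ∧ ContinuousOn V (Icc 0 1) ∧ ContinuousOn Uz (Icc 0 1) ∧
      ContinuousOn Vz (Icc 0 1) ∧ ContinuousOn Uw (Icc 0 1) ∧ ContinuousOn Vw (Icc 0 1))
    (hderiv : ∀ x ∈ Ioo (0 : Fin 2 → ℝ) 1,
      HasDerivAt (fun s => U (Function.update x 0 s)) (Uz x) (x 0) ∧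
      HasDerivAt (fun s => V (Function.update x 0 s)) (Vz x) (x 0) ∧
      HasDerivAt (fun s => U (Function.update x 1 s)) (Uw x) (x 1) ∧
      HasDerivAt (fun s => V (Function.update x 1 s)) (Vw x) (x 1))
    (hne : ∀ x ∈ Icc (0 : Fin 2 → ℝ) 1, U x ^ 2 + V x ^ 2 ≠ 0)
    (htate : ∀ x ∈ Icc (0 : Fin 2 → ℝ) 1, x 1 = 0 → U x = 1 ∧ V x = 0)
    (hloop : ∀ x ∈ Icc (0 : Fin 2 → ℝ) 1, x 0 = 0 →
      U (Function.update x 0 1) = U x ∧ V (Function.update x 0 1) = V x)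
    (rarg rmod : KZ.IntegralRep 1)
    (hdarg : rarg.domain = {y | y 0 ∈ Ioo (0 : ℝ) 1})
    (hiarg : EqOn rarg.integrand (fun y =>
      (U ![y 0, 1] * Vz ![y 0, 1] - V ![y 0, 1] * Uz ![y 0, 1]) / (U ![y 0, 1] ^ 2 + V ![y 0, 1] ^ 2))
      rarg.domain)
    (hdmod : rmod.domain = {y | y 0 ∈ Ioo (0 : ℝ) 1})
    (himod : EqOn rmod.integrand (fun y =>
      (U ![y 0, 1] * Uz ![y 0, 1] + V ![y 0, 1] * Vz ![y 0, 1]) / (U ![y 0, 1] ^ 2 + V ![y 0, 1] ^ 2))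
      rmod.domain) :
    KZ.of rarg ∈ KZ.relations ∧ KZ.of rmod ∈ KZ.relations := by
  sorry

/-! ## Sanity: the tree inputs named on the cards exist with the expected types -/

example := @Summit.KontsevichZagierPeriods.LiouvilleUnfolding.LogPrimitiveNL.Negative.baker_relation_span_int
example := @Summit.KontsevichZagierPeriods.LiouvilleUnfolding.LogPrimitiveNL.Negative.baker_sum_eq_zero
example := @Summit.KontsevichZagierPeriods.KontsevichZagierPeriods.BetaCancellationLine.stub_moebiusMove
example := @KZ.scale_mem_relations
example := @baker_holds

end Summit.KontsevichZagierPeriods.KontsevichZagierPeriods.Cruxes.TateFamilyKernelCurves.SketchIdeator2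

end
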